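import Literature.MathematicalPhysics.QuantumLattice.XXZGraphAutomorphism
import HarnessLib

/-!
# The bond-weighted XXZ Hamiltonian on a finite graph

The XXZ Hamiltonian with bond-dependent couplings
`H = Σ_{{x,y} ∈ E(G)} J_{xy} (Sˣ_x Sˣ_y + Sʸ_x Sʸ_y + Δ Sᶻ_x Sᶻ_y)` of spin `n/2` on a finite graph `G`
(`xxzHamiltonianWith`): the common generalisation of the tree's `xxzHamiltonian n G J Δ` (constant
coupling `J`; `xxzHamiltonianWith_const`) and `heisenbergWith n G J` (bond-dependent couplings,
isotropic point `Δ = 1`; `xxzHamiltonianWith_one`).  Source: H. Tasaki, *Physics and Mathematics of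
Quantum Many-Body Systems* (Springer 2020), §2.4, eq. (2.4.1) (bond-dependent exchange `J_{x,y}`) and
the remarks after it (XXZ anisotropy).  Motivation in the tree: the monotone-transport conjectures of
`Summits/HubbardSuperconductivity/…/AnisotropyChordSpinMonotoneDefs` on ANISOTROPIC lattices / weighted
vertex-transitive graphs (theory seat `hubbard-h0-rotor-theory-1`, cycles 4–5: `WeightedVTSpinMonotone`,
two-ring tori `ℤ_L × ℤ_2` with rung coupling `c/L²`, weighted rook graphs `K_m □ K_n` with direction
weights `J₁ ≠ J₂`) need a Hamiltonian with bond weights; this file supplies it with its elementary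
algebra: constant weights (`xxzHamiltonianWith_const`), the isotropic point (`xxzHamiltonianWith_one`),
Hermiticity (`xxzHamiltonianWith_isHermitian`), the affine pencil in `Δ`
(`xxzHamiltonianWith_affine`), and invariance under weight-preserving graph automorphisms
(`xxzHamiltonianWith_submatrix_comp`).  Nothing about spectra or order is claimed here.
-/

noncomputable section

open Matrix Finset

namespace Literature.MathematicalPhysics.QuantumLattice

variable {Λ : Type*} [Fintype Λ] [DecidableEq Λ] (n : ℕ) (G : SimpleGraph Λ) [DecidableRel G.Adj]

/-- The **bond-weighted XXZ Hamiltonian**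
`H = Σ_{{x,y} ∈ E(G)} J_{xy} (Sˣ_x Sˣ_y + Sʸ_x Sʸ_y + Δ Sᶻ_x Sᶻ_y)` of spin `n/2` on the finite graph
`G`, with bond-dependent couplings `J : Sym2 Λ → ℝ` (only the values on edges matter) and anisotropy
`Δ`.  For constant `J` this is `xxzHamiltonian n G J Δ`; at `Δ = 1` it is `heisenbergWith n G J`.
Tasaki (2020) §2.4, eq. (2.4.1) and the remarks after it. [cite: Tasaki2020, §2.4 eq. (2.4.1)] -/
def xxzHamiltonianWith (J : Sym2 Λ → ℝ) (Δ : ℝ) : Op Λ (n + 1) :=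
  ∑ e ∈ G.edgeFinset, (J e : ℂ) •
    Sym2.lift ⟨fun x y => spinBond n 0 x y + spinBond n 1 x y + (Δ : ℂ) • spinBond n 2 x y,
      fun x y => by simp only [spinBond_comm]⟩ e

/-- Constant couplings: `xxzHamiltonianWith n G (fun _ => J) Δ = xxzHamiltonian n G J Δ` (Tasaki's
uniform-coupling XXZ model, remarks after eq. (2.4.1)). [cite: Tasaki2020, §2.4 eq. (2.4.1)] -/
theorem xxzHamiltonianWith_const (J Δ : ℝ) :
    xxzHamiltonianWith n G (fun _ => J) Δ = xxzHamiltonian n G J Δ := by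
  unfold xxzHamiltonianWith xxzHamiltonian
  rw [Finset.smul_sum]

/-- The isotropic point `Δ = 1` is the bond-dependent Heisenberg Hamiltonian of eq. (2.4.1):
`xxzHamiltonianWith n G J 1 = heisenbergWith n G J`. [cite: Tasaki2020, §2.4 eq. (2.4.1)] -/
theorem xxzHamiltonianWith_one (J : Sym2 Λ → ℝ) :
    xxzHamiltonianWith n G J 1 = heisenbergWith n G J := by
  unfold xxzHamiltonianWith heisenbergWith
  refine Finset.sum_congr rfl fun e _ => ?_
  congr 1
  induction e using Sym2.ind with
  | h x y =>
    simp only [Sym2.lift_mk, spinDotSym_mk, spinDot, Complex.ofReal_one, one_smul, Fin.sum_univ_three]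

/-- The weighted XXZ Hamiltonian with real couplings and real anisotropy is Hermitian (self-adjointness
of the Hamiltonian (2.4.1)). [cite: Tasaki2020, §2.4 eq. (2.4.1)] -/
theorem xxzHamiltonianWith_isHermitian (J : Sym2 Λ → ℝ) (Δ : ℝ) :
    (xxzHamiltonianWith n G J Δ).IsHermitian := by
  unfold xxzHamiltonianWith
  rw [IsHermitian, conjTranspose_sum]
  refine Finset.sum_congr rfl fun e _ => ?_
  refine (IsHermitian.smul (xxzEdgeTerm_isHermitian n Δ e) ?_).eq
  rw [isSelfAdjoint_iff, Complex.star_def, Complex.conj_ofReal]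

/-- **The weighted XXZ family is an affine pencil in the anisotropy**:
`H(Δ) = H(0) + Δ·(H(1) − H(0))` (the `Δ`-dependence of (2.4.1) with anisotropy is linear).
[cite: Tasaki2020, §2.4 eq. (2.4.1)] -/
theorem xxzHamiltonianWith_affine (J : Sym2 Λ → ℝ) (Δ : ℝ) :
    xxzHamiltonianWith n G J Δ =
      xxzHamiltonianWith n G J 0 +
        ((Δ : ℝ) : ℂ) • (xxzHamiltonianWith n G J 1 - xxzHamiltonianWith n G J 0) := by
  have key : ∀ Δ' : ℝ, xxzHamiltonianWith n G J Δ' = xxzHamiltonianWith n G J 0 +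
      ((Δ' : ℝ) : ℂ) • ∑ e ∈ G.edgeFinset, (J e : ℂ) •
        Sym2.lift ⟨fun x y => spinBond n 2 x y, fun x y => by simp only [spinBond_comm]⟩ e := by
    intro Δ'
    unfold xxzHamiltonianWith
    rw [Finset.smul_sum, ← Finset.sum_add_distrib]
    refine Finset.sum_congr rfl fun e _ => ?_
    induction e using Sym2.ind with
    | h x y =>
      simp only [Sym2.lift_mk, Complex.ofReal_zero, zero_smul, add_zero, smul_add, smul_comm ((Δ' : ℝ) : ℂ) ((J s(x, y) : ℝ) : ℂ)]
  have h1 : xxzHamiltonianWith n G J 1 - xxzHamiltonianWith n G J 0 =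
      ∑ e ∈ G.edgeFinset, (J e : ℂ) •
        Sym2.lift ⟨fun x y => spinBond n 2 x y, fun x y => by simp only [spinBond_comm]⟩ e := by
    rw [key 1, Complex.ofReal_one, one_smul, add_sub_cancel_left]
  rw [h1]
  exact key Δ

/-- **The weighted XXZ Hamiltonian is invariant under weight-preserving graph automorphisms.**  If
`π` is a permutation of the sites preserving adjacency and the couplings (`J(π e) = J(e)`), then
relabelling tensor indices by `σ ↦ σ ∘ π` fixes `xxzHamiltonianWith n G J Δ` (symmetry of the
Hamiltonian under lattice automorphisms). [cite: Tasaki2020, §2.1] -/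
theorem xxzHamiltonianWith_submatrix_comp (J : Sym2 Λ → ℝ) (Δ : ℝ) (π : Λ ≃ Λ)
    (hπ : ∀ x y : Λ, G.Adj (π x) (π y) ↔ G.Adj x y) (hJ : ∀ e : Sym2 Λ, J (Sym2.map π e) = J e) :
    (xxzHamiltonianWith n G J Δ).submatrix (fun σ : TensorIndex Λ (n + 1) => σ ∘ π)
        (fun σ => σ ∘ π) = xxzHamiltonianWith n G J Δ := by
  have hmem : ∀ (ρ : Λ ≃ Λ), (∀ x y : Λ, G.Adj (ρ x) (ρ y) ↔ G.Adj x y) →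
      ∀ e : Sym2 Λ, Sym2.map ρ e ∈ G.edgeFinset ↔ e ∈ G.edgeFinset := by
    intro ρ hρ e
    induction e using Sym2.ind with
    | h x y =>
      rw [Sym2.map_mk, SimpleGraph.mem_edgeFinset, SimpleGraph.mem_edgeSet,
        SimpleGraph.mem_edgeFinset, SimpleGraph.mem_edgeSet, hρ]
  have hπ' : ∀ x y : Λ, G.Adj (π.symm x) (π.symm y) ↔ G.Adj x y := fun x y => by
    conv_rhs => rw [← π.apply_symm_apply x, ← π.apply_symm_apply y]
    exact (hπ _ _).symm
  simp only [xxzHamiltonianWith, submatrix_finset_sum, submatrix_smul, Pi.smul_apply]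
  refine Finset.sum_nbij' (Sym2.map π) (Sym2.map π.symm) (fun e he => ?_) (fun e he => ?_)
    (fun e _ => ?_) (fun e _ => ?_) (fun e _ => ?_)
  · exact (hmem π hπ e).2 he
  · exact (hmem π.symm hπ' e).2 he
  · simp only [Sym2.map_map, Equiv.symm_comp_self, Sym2.map_id', id_eq]
  · simp only [Sym2.map_map, Equiv.self_comp_symm, Sym2.map_id', id_eq]
  · rw [hJ e]
    induction e using Sym2.ind with
    | h x y =>
      simp only [Sym2.map_mk, Sym2.lift_mk, submatrix_add, submatrix_smul, Pi.add_apply,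
        Pi.smul_apply, spinBond_submatrix_comp]

end Literature.MathematicalPhysics.QuantumLattice
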